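import Mathlib
import HarnessLib
import Summits.NavierStokesRegularity.FluidComputer.BurgersColumnarFlowMap
import Summits.NavierStokesRegularity.FluidComputer.BurgersColumnarJacobian

/-!
# Burgers-tube heredity: the co-moving-frame chain rule instantiated for the columnar swirl
# (HEREDITY-P3 (A)(iii) for every off-axis trajectory — glue between `BurgersColumnarFlowMap` and
# `BurgersColumnarJacobian`)

HONEST FRAMING (cell `ns-blowup`, seat `ns-blowup-instab2`; human ruling D-0035): nothing here is a
claim about Navier–Stokes blow-up. WHAT THIS IS NOT: not dynamics of any real flow. This file only
plugs the swirl's winding `W(ρ) = ∫₀ᵗ Ω(ρe^{−σs/2}) ds` (derivative `D` by `hasDerivAt_angle_radius`,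
shear bound `(aρD)² ≤ K²a²`, `K = 2ρM/σ`, by `swirl_shear_sq_le`) into the general planar-Jacobian
sandwich of `BurgersColumnarJacobian.planar_jacobian_sandwich`. Mathlib + the two kernel files.
LABEL: MODEL/kinematic bookkeeping.
-/

namespace Summit.NavierStokesRegularity.FluidComputer.BurgersColumnarJacobianSwirl

open Real MeasureTheory intervalIntegral

section Swirl

/-! ## Instantiation: the columnar swirl's own winding (`BurgersColumnarFlowMap.hasDerivAt_angle_radius`,
`swirl_shear_sq_le`) -/

/-- **HEREDITY-P3 (A)(iii), every trajectory, kernel form.** For a `C¹` swirl profile `Ω` with `|Ω′| ≤ M`,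
parent strain `σ > 0`, time `t ≥ 0` and any off-axis initial point `(ρ cos φ, ρ sin φ)`, `ρ > 0`: the planar
flow map `p ↦ e^{−σt/2} R(W(|p|)) p`, `W(ρ) = ∫₀ᵗ Ω(ρe^{−σs/2}) ds`, has Cartesian Jacobian `J` (entries =
`BurgersColumnarJacobian` §1's partials with `D = ∫₀ᵗ Ω′(ρe^{−σs/2}) e^{−σs/2} ds`) satisfying, with `K = 2ρM/σ`,
`e^{−σt}|v|² ≤ 2(1+K²)|Jv|²` and `|Jv|² ≤ 2(1+K²) e^{−σt}|v|²` for every `v` — transverse Lyapunov exponents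
exactly `−σ/2, −σ/2` (the axial map `z ↦ z e^{σt}` is decoupled: exponent `σ`). -/
theorem swirl_planar_jacobian_sandwich {Ω' : ℝ → ℝ} (hΩ' : Continuous Ω') {M σ t ρ : ℝ}
    (hM : ∀ x, |Ω' x| ≤ M) (hσ : 0 < σ) (ht : 0 ≤ t) (hρ : 0 ≤ ρ) (φ W₀ v₁ v₂ : ℝ) :
    let a := Real.exp (-(σ / 2) * t)
    let D := ∫ s in (0 : ℝ)..t, Ω' (ρ * Real.exp (-(σ / 2) * s)) * Real.exp (-(σ / 2) * s)
    let K := 2 * ρ * M / σ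
    let J₁₁ := a * (Real.cos W₀ - ρ * D * Real.cos φ * (Real.cos φ * Real.sin W₀ + Real.sin φ * Real.cos W₀))
    let J₁₂ := a * (-Real.sin W₀ - ρ * D * Real.sin φ * (Real.cos φ * Real.sin W₀ + Real.sin φ * Real.cos W₀))
    let J₂₁ := a * (Real.sin W₀ + ρ * D * Real.cos φ * (Real.cos φ * Real.cos W₀ - Real.sin φ * Real.sin W₀))
    let J₂₂ := a * (Real.cos W₀ + ρ * D * Real.sin φ * (Real.cos φ * Real.cos W₀ - Real.sin φ * Real.sin W₀))
    Real.exp (-σ * t) * (v₁ ^ 2 + v₂ ^ 2) ≤ 2 * (1 + K ^ 2) * ((J₁₁ * v₁ + J₁₂ * v₂) ^ 2 + (J₂₁ * v₁ + J₂₂ * v₂) ^ 2) ∧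
      (J₁₁ * v₁ + J₁₂ * v₂) ^ 2 + (J₂₁ * v₁ + J₂₂ * v₂) ^ 2 ≤ 2 * (1 + K ^ 2) * (Real.exp (-σ * t) * (v₁ ^ 2 + v₂ ^ 2)) := by
  intro a D K J₁₁ J₁₂ J₂₁ J₂₂
  have hshear := BurgersColumnarFlowMap.swirl_shear_sq_le hΩ' hM hσ ht hρ (t := t)
  have hb : (a * ρ * D) ^ 2 ≤ K ^ 2 * a ^ 2 := by
    have e : a * ρ * D = ρ * Real.exp (-(σ / 2) * t) * D := by ring
    rw [e]; exact hshear
  have ha2 : a ^ 2 = Real.exp (-σ * t) := by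
    show Real.exp (-(σ / 2) * t) ^ 2 = Real.exp (-σ * t)
    rw [← Real.exp_nat_mul]; congr 1; ring
  have h := BurgersColumnarJacobian.planar_jacobian_sandwich a ρ D φ W₀ v₁ v₂ hb
  rw [ha2] at h
  exact h

/-- … and the winding profile IS differentiable with that `D`: the hypothesis `HasDerivAt W D ρ` of §1 is
discharged for `W(ρ) = ∫₀ᵗ Ω(ρe^{−σs/2}) ds` by `BurgersColumnarFlowMap.hasDerivAt_angle_radius` (with `θ₀ = 0`). -/
theorem swirl_winding_hasDerivAt {Ω Ω' : ℝ → ℝ} (hΩ : ∀ x, HasDerivAt Ω (Ω' x) x) (hΩ' : Continuous Ω')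
    {M : ℝ} (hM : ∀ x, |Ω' x| ≤ M) (σ t ρ : ℝ) :
    HasDerivAt (fun ρ' : ℝ => ∫ s in (0 : ℝ)..t, Ω (ρ' * Real.exp (-(σ / 2) * s)))
      (∫ s in (0 : ℝ)..t, Ω' (ρ * Real.exp (-(σ / 2) * s)) * Real.exp (-(σ / 2) * s)) ρ := by
  have h := BurgersColumnarFlowMap.hasDerivAt_angle_radius hΩ hΩ' hM σ 0 t ρ
  simpa using h

end Swirl

end Summit.NavierStokesRegularity.FluidComputer.BurgersColumnarJacobianSwirl
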